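import Summits.QuantumFields.YangMills.Theorems.VirialFluxGapRingTwistEaterForm
import Summits.QuantumFields.YangMills.Theorems.VirialFluxGapTwistEaterSignClass
import Summits.QuantumFields.YangMills.Theorems.VirialFluxGapRingGaugeAction
import Summits.QuantumFields.YangMills.Theorems.LuscherReductionTwistedTraceScalingValleyLinkProx
import HarnessLib

/-!
# The zero set of the twisted ring deficit is the union of the gauge orbits of the sign-class twist-eater rings
# (layer (B1) capstone of the DIRECT Laplace road to ⟨stmt-QuantumFields-24204⟩ `VirialFluxGap.SharpTwistedLaplace`)

Helper module (free-hands work of width seat ym-line-sfw-p2-w2 g49, cell ym-idea-1).  ★ `ringDeficit_eq_zero_iff_exists_gauge_signClass`: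
for `L ≥ 2`, `z ≠ 0`, a twist-sign field `λ` and a reference pair `(N₀, C₀)` of trace-free `SU(2)` elements with orthogonal quaternion axes, a
ring history `P` is a zero of `F_z` IFF `P = h · R_s` for a gauge transformation `h` and a sign pattern `s : Fin 3 → Bool`, where
`R_s = (combFlat(k ↦ centreElem(s_k)·(N₀ if z_k else 1)) on every slice; seam x ↦ λ(x)·C₀)` and `h · (U⃗, g) = ((h·U_i)_i, h g h⁻¹)` is the
gauge action of ✓`VirialFluxGapRingGaugeAction`.  Hence `{F_z = 0} = ⋃_{s ∈ (ℤ/2)³} 𝒢 · R_s` (8 patterns, 4 distinct orbits): the critical set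
of the Laplace phase is a finite union of gauge orbits of twist-eaters, as the orbit theorems `laplaceMethod_quantitative_orbit(_tube)` /
`_sum_of_tubes` require.  Everything here is PROVED; no definitions, no named facts.  HONEST FRAMING: algebra∕bookkeeping; ⟨24204⟩, ⟨24319⟩
and every rung stay OPEN; the Yang–Mills mass gap (Clay) is NOT touched; no summit is proved by a line.
-/

noncomputable section

open scoped Quaternion Matrix BigOperators
open Literature.MathematicalPhysics.QuantumFieldTheory hiding SU2 su2Quat_mul
open Literature.MathematicalPhysics.QuantumLattice
open Literature.MathematicalPhysics.QuantumFieldTheory.Balaban1983to89.T4WilsonGaugeFlatDirection (su2Quat_injective)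
open Literature.MathematicalPhysics.QuantumFieldTheory.Balaban1983to89.T4HaarSU2Translate (su2Quat_mul)
open Summit.QuantumFields.YangMills.Theorems.FemtoTransferGap
open Summit.QuantumFields.YangMills.Theorems.FemtoTransferGap.TT
open Summit.QuantumFields.YangMills.Theorems.FemtoTransferGap.TwoLattice
open Summit.QuantumFields.YangMills.Theorems.FemtoTransferGap.TwoLattice.Flat
open Summit.QuantumFields.YangMills.Theorems.ToronValleyVolume.Lojasiewicz
open Summit.QuantumFields.YangMills.Theorems.TwistEaterVolume.Quadratic
open Summit.QuantumFields.YangMills.Theorems.QuantitativeLaplace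

namespace Summit.QuantumFields.YangMills.Theorems.VirialFluxGap.RingDeficit

variable {L : ℕ} [NeZero L]

/-- The sign-class wraps `w_s(k) = centreElem(s_k)·(N₀ if z_k else 1)` commute and satisfy the twist-eater relations with `C₀`
(transported from ✓`twistEater_of_signs`). [folklore] -/
theorem signClass_relations (z s : Fin 3 → Bool) {N₀ C₀ : SU2} (hN : (su2Quat N₀).re = 0) (hC : (su2Quat C₀).re = 0)
    (hNC : (su2Quat N₀).imI * (su2Quat C₀).imI + (su2Quat N₀).imJ * (su2Quat C₀).imJ + (su2Quat N₀).imK * (su2Quat C₀).imK = 0) :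
    (∀ i j, (centreElem (s i) * (if z i then N₀ else 1)) * (centreElem (s j) * (if z j then N₀ else 1)) =
        (centreElem (s j) * (if z j then N₀ else 1)) * (centreElem (s i) * (if z i then N₀ else 1))) ∧
    (∀ k, C₀ * (centreElem (s k) * (if z k then N₀ else 1)) * C₀⁻¹ = centreElem (z k) * (centreElem (s k) * (if z k then N₀ else 1))) := by
  have hCN : (su2Quat C₀).imI * (su2Quat N₀).imI + (su2Quat C₀).imJ * (su2Quat N₀).imJ + (su2Quat C₀).imK * (su2Quat N₀).imK = 0 := by
    linarith [hNC]
  have hu' : ∀ k, su2Quat (centreElem (s k) * (if z k then N₀ else 1)) =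
      (if s k then (-1 : ℝ) else 1) • (if z k then su2Quat N₀ else (1 : ℍ)) := fun k => by
    rw [su2Quat_mul (centreElem (s k)), su2Quat_centreElem (s k)]
    cases s k <;> cases z k <;> simp [su2Quat_one]
  obtain ⟨hcomm, htw, hun⟩ := twistEater_of_signs hC hN hCN z (fun k => if s k then (-1 : ℝ) else 1)
    (fun k => su2Quat (centreElem (s k) * (if z k then N₀ else 1))) hu'
  refine ⟨fun i j => su2Quat_injective ?_, fun k => ?_⟩
  · have h := hcomm i j
    rwa [← su2Quat_mul, ← su2Quat_mul] at h
  · rw [mul_inv_eq_iff_eq_mul]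
    apply su2Quat_injective
    rw [su2Quat_mul C₀, su2Quat_mul (centreElem (z k) * _) C₀, su2Quat_mul (centreElem (z k)), su2Quat_centreElem (z k)]
    by_cases hk : z k = true
    · rw [htw k hk]
      simp [if_pos hk]
    · have hk' : z k = false := by simpa using hk
      rw [hun k hk']
      simp [hk']

/-- ★ **The zero set of the twisted deficit = the gauge orbits of the sign-class twist-eater rings.** [cite: Luscher1983, §2]
[cite: GonzalezarroyoAltes1988, §2] -/
theorem ringDeficit_eq_zero_iff_exists_gauge_signClass (hL : 2 ≤ L) (z : Fin 3 → Bool) (hz : z ≠ fun _ => false)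
    {lam : Site 3 L → SU2} (hlamc : ∀ x, lam x ∈ Subgroup.center SU2) (hlam0 : lam 0 = 1)
    (hlamflip : ∀ (x : Site 3 L) (k : Fin 3), (x k = 0 ∨ x k = -1) → lam (x.shift k) = lam x * centreElem (z k))
    (hlamstay : ∀ (x : Site 3 L) (k : Fin 3), x k ≠ 0 → x k ≠ -1 → lam (x.shift k) = lam x)
    {N₀ C₀ : SU2} (hN : (su2Quat N₀).re = 0) (hC : (su2Quat C₀).re = 0)
    (hNC : (su2Quat N₀).imI * (su2Quat C₀).imI + (su2Quat N₀).imJ * (su2Quat C₀).imJ + (su2Quat N₀).imK * (su2Quat C₀).imK = 0)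
    (P : (Fin (2 * L - 1 + 1) → GaugeConfig 3 L SU2) × (Site 3 L → SU2)) :
    ringDeficit L z P = 0 ↔ ∃ (s : Fin 3 → Bool) (h : Site 3 L → SU2),
      P = ((fun _ => gaugeTransform h (combFlat fun k => centreElem (s k) * (if z k then N₀ else 1))),
            h * (fun x => lam x * C₀) * h⁻¹) := by
  have hlcomm : ∀ (x : Site 3 L) (a : SU2), lam x * a = a * lam x := fun x a => centre_comm (hlamc x) a
  constructor
  · intro hP
    obtain ⟨t, w, c, hww, hcw, hP1, hP2⟩ := exists_combGauge_of_ringDeficit_eq_zero hL z hlamc hlam0 hlamflip hlamstay P hP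
    obtain ⟨s, g₀, hgw, hgc⟩ := exists_conj_signClass_of_twistEater z hz hww hcw hN hC hNC
    refine ⟨s, fun x => (t x)⁻¹ * g₀⁻¹, Prod.ext ?_ ?_⟩
    · funext i
      rw [hP1 i]
      have hw : combFlat w = gaugeTransform (fun _ : Site 3 L => g₀⁻¹) (combFlat fun k => centreElem (s k) * (if z k then N₀ else 1)) := by
        rw [gaugeTransform_const_combFlat]
        congr 1
        funext k
        rw [← hgw k, inv_inv]
        group
      rw [hw, gaugeTransform_gaugeTransform]
      rfl
    · funext x
      rw [hP2 x]
      have hc : c = g₀⁻¹ * C₀ * g₀ := by rw [← hgc]; group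
      have e : lam x * c = g₀⁻¹ * (lam x * C₀) * g₀ := by
        calc lam x * c = lam x * g₀⁻¹ * C₀ * g₀ := by rw [hc]; simp only [mul_assoc]
          _ = g₀⁻¹ * lam x * C₀ * g₀ := by rw [hlcomm x g₀⁻¹]
          _ = g₀⁻¹ * (lam x * C₀) * g₀ := by simp only [mul_assoc]
      rw [e]
      simp only [Pi.mul_apply, Pi.inv_apply, mul_inv_rev, inv_inv, mul_assoc]
  · rintro ⟨s, h, rfl⟩
    obtain ⟨hww, hcw⟩ := signClass_relations z s hN hC hNC
    have h0 := ringDeficit_combGauge_eq_zero hL z hlamc hlamflip hlamstay (1 : Site 3 L → SU2) hww hcw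
    have h1 : ringDeficit L z
        (((fun _ => combFlat fun k => centreElem (s k) * (if z k then N₀ else 1)), fun x => lam x * C₀) :
          (Fin (2 * L - 1 + 1) → GaugeConfig 3 L SU2) × (Site 3 L → SU2)) = 0 := by
      convert h0 using 3
      · funext i
        rw [inv_one]
        funext e
        simp [gaugeTransform]
      · funext x
        simp
    rw [← h1]
    exact ringDeficit_ringGaugeAct z h
      (((fun _ => combFlat fun k => centreElem (s k) * (if z k then N₀ else 1)), fun x => lam x * C₀) :
        (Fin (2 * L - 1 + 1) → GaugeConfig 3 L SU2) × (Site 3 L → SU2))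

end Summit.QuantumFields.YangMills.Theorems.VirialFluxGap.RingDeficit
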